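import Mathlib
import Literature.NumberTheory.EllipticCurves.MordellWeilModNCard

/-!
# Rank-2 observatory — KERNEL-3ISO (A1): the rank upper bound from the two `3`-isogeny descent maps

HONEST FRAMING: per-curve certified theorems and census instruments; no claim on BSD in rank ≥ 2.

Abstract bookkeeping of descent via a `3`-isogeny (Cohen, *Number Theory I*, GTM 239, Prop. 8.2.8 / §8.4, and
Cohen–Pazuki, *Elementary 3-descent with a 3-isogeny*, Acta Arith. 140 (2009), Prop. 2.2: `|Im α|·|Im α̂| =
3^{r+1}` — here as the inequality the rank bound needs, with the images replaced by explicit finite supersets).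

Let `Γ = E(K)` (a number field `K`, `E` elliptic, `Γ` finitely generated of rank `r = mordellWeilRank`), `B` any
abelian group (in the application `B = Ê(K)`), `φ : Γ → B`, `ψ : B → Γ` additive with `ψ ∘ φ = 3`, `T ∈ Γ` a point
of order `3`, and `κ : Γ → G`, `κ' : B → G'` additive maps into abelian groups with `ker κ ⊆ ψ(B)` and
`ker κ' ⊆ φ(Γ)` (Kummer injectivity, Cohen Prop. 8.4.8 (2)–(3)) whose values lie in finite sets `S`, `S'`. Then

`3 ^ (r + 1) ≤ #S · #S'`   (`three_pow_mordellWeilRank_succ_le`).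

Chain: `3^r · #Γ[3] = (Γ : 3Γ)` (`natCard_quotient_nsmulRange_point_eq`, tree); `#Γ[3] ≥ 3` (`𝒪, T, -T`);
`(Γ : 3Γ) · (ker ψ : ker ψ ∩ φΓ) = (Γ : ψB) · (B : φΓ)` (the index identity, verbatim the tree's
`index_nsmulRange_mul_relIndex_eq` with `2 ↦ 3`); `(Γ : ψB) ≤ (Γ : ker κ) = #κ(Γ) ≤ #S` and likewise for `κ'`.
No property of `B` beyond commutativity is used (in particular no finiteness of `ker ψ`).

## References
* H. Cohen, *Number Theory, Volume I: Tools and Diophantine Equations*, GTM 239 (2007), §8.4 (Prop. 8.4.3,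
  8.4.4, 8.4.8) and Prop. 8.2.8. [cite: Cohen2007NumberTheoryI, §8.4]
* H. Cohen, F. Pazuki, *Elementary 3-descent with a 3-isogeny*, Acta Arith. 140 (2009) 369–404, Prop. 2.2.
  [cite: CohenPazuki2009, Prop. 2.2]
-/

set_option linter.dupNamespace false

noncomputable section

open scoped Classical

namespace Summit.BirchSwinnertonDyer.BirchSwinnertonDyer.Rank2Observatory.ThreeIso

open Literature.NumberTheory.EllipticCurves

/-! ### Pure group theory -/

/-- **The index identity** `(A : nA) · (ker ψ : ker ψ ∩ φA) = (A : ψB) · (B : φA)` for additive maps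
`φ : A → B`, `ψ : B → A` with `ψ ∘ φ = n` (Cohen GTM 239, proof of Prop. 8.2.8: "`[ψ̂(A) : ψ̂(B)] =
[A : B] / [Ker ψ̂ : Ker ψ̂ ∩ B]`"). [cite: Cohen2007NumberTheoryI, Prop. 8.2.8 (proof)] -/
theorem index_nsmulRange_mul_relIndex_eq {A B : Type*} [AddCommGroup A] [AddCommGroup B] (n : ℕ)
    (φ : A →+ B) (ψ : B →+ A) (h : ∀ a, ψ (φ a) = n • a) :
    (nsmulAddMonoidHom n : A →+ A).range.index * φ.range.relIndex ψ.ker =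
      ψ.range.index * φ.range.index := by
  -- `nA = ψ(φ(A))`
  have hnA : (nsmulAddMonoidHom n : A →+ A).range = φ.range.map ψ := by
    ext x
    simp only [AddMonoidHom.mem_range, nsmulAddMonoidHom_apply, AddSubgroup.mem_map]
    constructor
    · rintro ⟨a, rfl⟩
      exact ⟨φ a, ⟨a, rfl⟩, h a⟩
    · rintro ⟨_, ⟨a, rfl⟩, rfl⟩
      exact ⟨a, (h a).symm⟩
  have h1 : (φ.range.map ψ).relIndex ψ.range * ψ.range.index = (φ.range.map ψ).index :=
    AddSubgroup.relIndex_mul_index (AddSubgroup.map_le_range ψ _)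
  have h2 : (φ.range.map ψ).relIndex ψ.range = (φ.range ⊔ ψ.ker).index := by
    rw [← AddSubgroup.comap_map_eq ψ φ.range, ← AddSubgroup.relIndex_top_right,
      AddSubgroup.relIndex_comap, ← AddMonoidHom.range_eq_map]
  have h3 : φ.range.relIndex (φ.range ⊔ ψ.ker) * (φ.range ⊔ ψ.ker).index = φ.range.index :=
    AddSubgroup.relIndex_mul_index le_sup_left
  have h4 : φ.range.relIndex (φ.range ⊔ ψ.ker) = φ.range.relIndex ψ.ker :=
    AddSubgroup.relIndex_sup_left ψ.ker φ.range
  rw [hnA, ← h1, h2, ← h3, h4]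
  ring

/-- If an additive map `κ : A → G` has kernel inside `H` and takes values in a finite set `S`, then `H` has finite
index and `(A : H) ≤ #S` (`(A : H) ∣ (A : ker κ) = #κ(A) ≤ #S`). [folklore] -/
theorem index_ne_zero_and_le_card {A G : Type*} [AddCommGroup A] [AddCommGroup G]
    (H : AddSubgroup A) (κ : A →+ G) (hker : κ.ker ≤ H) (S : Finset G) (hS : ∀ a, κ a ∈ S) :
    H.index ≠ 0 ∧ H.index ≤ S.card := by
  have hrange : Set.range κ ⊆ (S : Set G) := by
    rintro _ ⟨a, rfl⟩; exact hS a
  have hfin : (Set.range κ).Finite := (Finset.finite_toSet S).subset hrange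
  have hcardle : Nat.card (Set.range κ) ≤ S.card := by
    have := Nat.card_mono (Finset.finite_toSet S) hrange
    simpa using this
  have hcard0 : Nat.card (Set.range κ) ≠ 0 := by
    haveI : Finite (Set.range κ) := hfin.to_subtype
    haveI : Nonempty (Set.range κ) := ⟨⟨κ 0, 0, rfl⟩⟩
    exact Nat.card_pos.ne'
  have hkerIdx : κ.ker.index = Nat.card (Set.range κ) := AddSubgroup.index_ker κ
  have hdvd : H.index ∣ κ.ker.index := AddSubgroup.index_dvd_of_le hker
  rw [hkerIdx] at hdvd
  refine ⟨fun h0 => hcard0 (Nat.eq_zero_of_zero_dvd (h0 ▸ hdvd)), ?_⟩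
  exact (Nat.le_of_dvd (Nat.pos_of_ne_zero hcard0) hdvd).trans hcardle

/-- `#A[3] ≥ 3` as soon as `A` has a nonzero element `T` with `3 • T = 0` (the elements `0, T, 2 • T` of `A[3]`
are distinct). [folklore] -/
theorem three_le_natCard_torsionBy {A : Type*} [AddCommGroup A] (T : A) (hT : 3 • T = 0) (hT0 : T ≠ 0)
    [Finite (AddSubgroup.torsionBy A ((3 : ℕ) : ℤ))] :
    3 ≤ Nat.card (AddSubgroup.torsionBy A ((3 : ℕ) : ℤ)) := by
  set T3 := AddSubgroup.torsionBy A ((3 : ℕ) : ℤ) with hT3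
  have hmem : ∀ k : ℕ, k • T ∈ T3 := fun k => by
    rw [hT3, AddSubgroup.torsionBy.nsmul_iff]
    rw [smul_comm, hT, smul_zero]
  -- the map `Fin 3 → T3`, `k ↦ k • T`, is injective
  let f : Fin 3 → T3 := fun k => ⟨(k : ℕ) • T, hmem k⟩
  have h2T : 2 • T ≠ 0 := by
    intro h
    have h3 : 3 • T = 2 • T + T := succ_nsmul T 2
    rw [hT, h, zero_add] at h3
    exact hT0 h3.symm
  have h2T' : 2 • T ≠ T := by
    intro h
    rw [two_nsmul] at h
    exact hT0 (add_eq_left.mp h)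
  have hf : Function.Injective f := by
    intro i j hij
    have hij' : (i : ℕ) • T = (j : ℕ) • T := by
      have := congrArg Subtype.val hij
      exact this
    fin_cases i <;> fin_cases j
    all_goals (first
      | rfl
      | (exfalso
         simp only [zero_nsmul, one_nsmul] at hij'
         first
           | exact hT0 hij'.symm
           | exact hT0 hij'
           | exact h2T hij'.symm
           | exact h2T hij'
           | exact h2T' hij'.symm
           | exact h2T' hij'))
  have := Nat.card_le_card_of_injective f hf
  simpa using this

/-! ### The rank bound -/

/-- **`3^{r+1} ≤ #S · #S'`** — the `3`-isogeny descent bound (Cohen GTM 239 §8.4 with Prop. 8.2.8;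
Cohen–Pazuki 2009, Prop. 2.2: `|Im α| |Im α̂| = 3^{r+1}` for `D = 1`). For `E` elliptic over a number field `K`
with `Γ = E(K)` of rank `r`, any abelian group `B`, additive `φ : Γ → B`, `ψ : B → Γ` with `ψ ∘ φ = 3`, a point
`T ∈ Γ` of order `3`, and additive `κ : Γ → G`, `κ' : B → G'` with `ker κ ⊆ ψ(B)`, `ker κ' ⊆ φ(Γ)` taking values in
finite sets `S`, `S'`: `3 ^ (r + 1) ≤ #S · #S'`. In the application `B = Ê(ℚ)`, `φ, ψ` the `3`-isogeny and its
dual, `κ = α` (`y - (ax+b)` mod cubes), `κ' = α̂`, and `S`, `S'` the classes not killed by a local certificate.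
[cite: Cohen2007NumberTheoryI, §8.4 (Prop. 8.4.8) and Prop. 8.2.8] [cite: CohenPazuki2009, Prop. 2.2] -/
theorem three_pow_mordellWeilRank_succ_le {K : Type*} [Field K] [NumberField K] (W : WeierstrassCurve K)
    [W.IsElliptic] {B G G' : Type*} [AddCommGroup B] [AddCommGroup G] [AddCommGroup G']
    (φ : W.toAffine.Point →+ B) (ψ : B →+ W.toAffine.Point) (h3 : ∀ P, ψ (φ P) = 3 • P)
    (T : W.toAffine.Point) (hT : 3 • T = 0) (hT0 : T ≠ 0)
    (κ : W.toAffine.Point →+ G) (κ' : B →+ G') (hκ : κ.ker ≤ ψ.range) (hκ' : κ'.ker ≤ φ.range)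
    (S : Finset G) (S' : Finset G') (hS : ∀ P, κ P ∈ S) (hS' : ∀ Q, κ' Q ∈ S') :
    3 ^ (W.mordellWeilRank + 1) ≤ S.card * S'.card := by
  set T3 := AddSubgroup.torsionBy W.toAffine.Point ((3 : ℕ) : ℤ) with hT3
  haveI : Module.Finite ℤ W.toAffine.Point := W.module_finite_point_holds
  haveI : Finite T3 := finite_torsionBy_of_moduleFinite W.toAffine.Point 3
  -- `(Γ : 3Γ) = 3^r · #Γ[3]`
  have hcount : (nsmulAddMonoidHom 3 : W.toAffine.Point →+ W.toAffine.Point).range.index =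
      3 ^ W.mordellWeilRank * Nat.card T3 := by
    rw [AddSubgroup.index_eq_card]
    exact natCard_quotient_nsmulRange_point_eq W 3
  -- the index identity
  have hidx := index_nsmulRange_mul_relIndex_eq 3 φ ψ h3
  -- the two Kummer bounds
  obtain ⟨hψ0, hψS⟩ := index_ne_zero_and_le_card ψ.range κ hκ S hS
  obtain ⟨hφ0, hφS⟩ := index_ne_zero_and_le_card φ.range κ' hκ' S' hS'
  -- `relIndex ≠ 0`, from the identity and the finiteness of the right-hand side
  have hrel : φ.range.relIndex ψ.ker ≠ 0 := by
    intro h0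
    rw [h0, mul_zero] at hidx
    exact mul_ne_zero hψ0 hφ0 hidx.symm
  have htor : 3 ≤ Nat.card T3 := three_le_natCard_torsionBy T hT hT0
  calc 3 ^ (W.mordellWeilRank + 1) = 3 ^ W.mordellWeilRank * 3 := pow_succ _ _
    _ ≤ 3 ^ W.mordellWeilRank * Nat.card T3 := Nat.mul_le_mul_left _ htor
    _ = (nsmulAddMonoidHom 3 : W.toAffine.Point →+ W.toAffine.Point).range.index := hcount.symm
    _ ≤ (nsmulAddMonoidHom 3 : W.toAffine.Point →+ W.toAffine.Point).range.index *
          φ.range.relIndex ψ.ker := Nat.le_mul_of_pos_right _ (Nat.pos_of_ne_zero hrel)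
    _ = ψ.range.index * φ.range.index := hidx
    _ ≤ S.card * S'.card := Nat.mul_le_mul hψS hφS

/-- The rank reading: under the hypotheses of `three_pow_mordellWeilRank_succ_le`, `#S · #S' < 3 ^ (s + 2)` gives
`rank ≤ s` (per sharp census row: `#S · #S' = 27`, `s = 2`). [cite: CohenPazuki2009, Prop. 2.2] -/
theorem mordellWeilRank_le_of_card_mul_card_lt {K : Type*} [Field K] [NumberField K] (W : WeierstrassCurve K)
    [W.IsElliptic] {B G G' : Type*} [AddCommGroup B] [AddCommGroup G] [AddCommGroup G']
    (φ : W.toAffine.Point →+ B) (ψ : B →+ W.toAffine.Point) (h3 : ∀ P, ψ (φ P) = 3 • P)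
    (T : W.toAffine.Point) (hT : 3 • T = 0) (hT0 : T ≠ 0)
    (κ : W.toAffine.Point →+ G) (κ' : B →+ G') (hκ : κ.ker ≤ ψ.range) (hκ' : κ'.ker ≤ φ.range)
    (S : Finset G) (S' : Finset G') (hS : ∀ P, κ P ∈ S) (hS' : ∀ Q, κ' Q ∈ S')
    {s : ℕ} (hs : S.card * S'.card < 3 ^ (s + 2)) : W.mordellWeilRank ≤ s := by
  have h := three_pow_mordellWeilRank_succ_le W φ ψ h3 T hT hT0 κ κ' hκ hκ' S S' hS hS'
  have hlt : 3 ^ (W.mordellWeilRank + 1) < 3 ^ (s + 2) := lt_of_le_of_lt h hs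
  have := (Nat.pow_lt_pow_iff_right (by norm_num : 1 < 3)).mp hlt
  omega

end Summit.BirchSwinnertonDyer.BirchSwinnertonDyer.Rank2Observatory.ThreeIso

end
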